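import Mathlib
import HarnessLib
import Summits.HubbardSuperconductivity.HubbardSuperconductivity.Theorems.KLProgrammeKLRegimeEngineFixedTupleYoung
import Summits.HubbardSuperconductivity.HubbardSuperconductivity.Theorems.KLProgrammeKLRegimeEngineScaleZeroValuesExplicit
import Summits.HubbardSuperconductivity.HubbardSuperconductivity.Theorems.KLProgrammeKLRegimeSplitValueIdentification
import Summits.HubbardSuperconductivity.HubbardSuperconductivity.Theorems.KLProgrammeKLRegimeSplitSpin01

/-!
# K3 ENGINE child (stmt-HubbardSuperconductivity-19855 `KLRegimeEngineV12`), stub `stub_engine_scale0`, clause (E5-S)₀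
# `IsoTupleL1AtS … 0` — values on the ball ⟹ fixed-tuple `L¹` at every isotropic resolution — MODULO the isotropic torus bound `T̂` and
# two package numbers

Cell gate-hubbard-kl, seat p3 (g6).  `IsoTupleL1AtS L M G P β U μ K 0`: for every `B ≥ 0` bounding the `↑↓` running coupling values
`λ₀(k₁,k₂,k₃)` on the ball, every resolution `m`, every isotropic tuple `Ω ∈ bgmSectorSet (klIsoFamily … m) 4` and every `x₁`,
`fixedTupleL1 β 3 (klIsoKernelAt … 0 m) Ω x₁ ≤ G.CF·B + G.CF·(Klam U)²`.  Route (HOME/p3/SCALE0-VALUES-AND-REMAINING.md §2):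

1. `fixedTupleL1_klIsoKernelAt_zero_le_of_torusSum` (`…EngineFixedTupleYoung`): with `T(m) ≤ T̂/ε_x`,
   `fixedTupleL1 ≤ T̂⁴·(U/2 + (N/β)·R₄/2)`, `R₄ = ρ⁻⁴e‖Ṽ‖_hθ/(1−θ)` the second-order remainder of the scale-`0` step;
2. the step data discharged as in `…EngineScaleZeroValuesExplicit` (`κ₀` sharp, `α = (N/β)·klScaleZeroA0`, `N₁ = (β/N)·klKappaFrameC R·U`,
   `θ ≤ klScaleZeroThetaC R·U ≤ 1/2`), whence `(N/β)·R₄ ≤ klScaleZeroValC R·U²/96` (`scaleZero_remainder_le`);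
3. `B`-ABSORPTION: an admissible isotropic tuple carries a lattice momentum `q` with `F_ω(q) ≠ 0`, hence `q ∈ klBall`
   (`mem_klBall_of_klIsoFamily_ne_zero`); reading the hypothesis at `(q,q,q)` and `λ₀(q,q,q) = 𝒞₀(2q;q,q) = U + O(U²)`
   (`klka_quarticValue_eq_pairAmplitude`, `norm_klPairAmplitude_zero_sub_le_sq`) gives `B ≥ U − klScaleZeroValC R·U²`; since the bare term is
   LINEAR in `U` it is absorbed by `G.CF·B` (not by `G.CF·(Klam U)²`), and the `R`-dependent `U²`-terms by the slack `B ≥ U/2` under a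
   `U₀(R)`-threshold (`G` is fixed before `R`; `U₀` after).

* **`isoTupleL1AtS_zero_of_torusSum`** — (E5-S)₀ for every admissible frame under: `FrameOK R U N μ K`, `R.WF`, `0 < U ≤ 1`, `klBetaMin ≤ β ≤ L`,
  `β³ ≤ M`, the package smallnesses `klScaleZeroThetaC R·U ≤ 1/2`, `klScaleZeroValC R·U ≤ 1/4`, ONE dimensionless torus bound `T̂ ≥ 0` with
  `T_iso(m; ω, c) ≤ T̂/ε_x` for EVERY resolution `m` (the isotropic sector lemma — OPEN, p4-lane symbol technology), and the package number
  `T̂⁴ ≤ G.CF`;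
* `isoTupleL1AtS_zero_of_klEng` — the same under the ENGINE's binders (`klEngL₃ β U ≤ L`, `klEngM₃ β U L ≤ M`).

Everything is proved; no definitions, no named facts, no sorry.  FINDING recorded in the docstring of the main theorem: the bare vertex makes
`G.CF ≥ T̂⁴/2·(…)` NECESSARY on this route (true `L¹` norms of sector multiplier kernels are `O(10)`, the certified `T̂` of the tree's `L²`-route is
`≫ 2^{13} = (2^{52})^{1/4}` and carries `sectorCircLineConst`) ⇒ a BY-NAME `G.CF` (G-package) unless the sector lemma's constant improves.
-/

noncomputable section

namespace Summit.HubbardSuperconductivity.HubbardSuperconductivity.Theorems.EngineV8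

set_option linter.dupNamespace false -- summit = problem name (single-conjunct summit), D-0017

open Real Finset Literature.MathematicalPhysics.QuantumLattice Literature.Probability.LatticeModels
open Literature.MathematicalPhysics.QuantumLattice.GrassmannAlgebra
open Summit.HubbardSuperconductivity.HubbardSuperconductivity.Theorems.KLRegimeSplit
open Summit.HubbardSuperconductivity.HubbardSuperconductivity.Theorems.KLProgrammeLegKernels
open Summit.HubbardSuperconductivity.HubbardSuperconductivity.Theorems.ScaleZeroDecay
open scoped ComplexConjugate

variable {L M : ℕ} [NeZero L]

/-! ## §1 Support of the isotropic multipliers: admissible tuples live on the ball -/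

/-- **An isotropic multiplier at resolution `m` is supported on the ball**: `F^{iso,m}_ω(k) ≠ 0 ⇒ k⃗ ∈ klBall` (the radial cutoff
`C_{-m}⁻¹(√(ν²+e_K²))` vanishes once `√(ν²+e_K²) ≥ e₀·4^{-m}`, and `e₀·4^{-m} ≤ e₀`). -/
theorem mem_klBall_of_klIsoFamily_ne_zero [NeZero M] (β μ : ℝ) (K : TrigPolyC4v) (m : ℕ) (ω : Fin (sectorCount (2 * m)))
    (k : FreqMomentum L M) (h : klIsoFamily L M β μ K klE0 m ω k ≠ 0) : k.2 ∈ klBall L μ K := by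
  rw [klBall, klShell, mem_momentumShell, klScale, pow_zero, inv_one, mul_one]
  by_contra hk
  rw [not_le] at hk
  apply h
  have he : (0 : ℝ) < klE0 := by norm_num [klE0]
  have hcut : gnScaleCutoff 4 klE0 (-(m : ℤ)) (Real.sqrt (matsubaraFreq β M k.1 ^ 2 + nambuXiCT L μ K k.2 ^ 2)) = 0 := by
    refine gnScaleCutoff_eq_zero (by norm_num) he ?_
    have h4 : (4 : ℝ) ^ (-(m : ℤ)) ≤ 1 := by
      rw [zpow_neg, zpow_natCast]
      exact inv_le_one_of_one_le₀ (one_le_pow₀ (by norm_num))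
    have h1 : klE0 * (4 : ℝ) ^ (-(m : ℤ)) ≤ klE0 := by nlinarith [zpow_pos (by norm_num : (0:ℝ) < 4) (-(m : ℤ))]
    have h2 : |nambuXiCT L μ K k.2| ≤ Real.sqrt (matsubaraFreq β M k.1 ^ 2 + nambuXiCT L μ K k.2 ^ 2) := by
      rw [← Real.sqrt_sq_eq_abs]
      exact Real.sqrt_le_sqrt (by nlinarith [sq_nonneg (matsubaraFreq β M k.1)])
    linarith
  rw [klIsoFamily, klIsoMultiplier, hcut, zero_mul, Complex.ofReal_zero]

/-- An admissible isotropic `4`-tuple carries a lattice momentum of the ball on its leg `0`. -/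
theorem exists_mem_klBall_of_mem_bgmSectorSet [NeZero M] (β μ : ℝ) (K : TrigPolyC4v) (m : ℕ)
    {Ω : Fin 4 → SectorLeg (sectorCount (2 * m))} (hΩ : Ω ∈ bgmSectorSet L M (klIsoFamily L M β μ K klE0 m) 4) :
    ∃ q : TorusSite 2 L, q ∈ klBall L μ K := by
  rw [bgmSectorSet, mem_filter] at hΩ
  obtain ⟨k, hk, -⟩ := hΩ.2
  exact ⟨(k 0).2, mem_klBall_of_klIsoFamily_ne_zero β μ K m _ (k 0) (hk 0)⟩

/-! ## §2 The lower bound on `B` from one ball value -/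

/-- **`B ≥ U − klScaleZeroValC R·U²`**: a bound `B` on the `↑↓` values over a NONEMPTY ball dominates `|λ₀(q,q,q)| = |𝒞₀(2q;q,q)| ≥ U − ValC·U²`. -/
theorem sub_le_of_values_le [NeZero M] {R : RenConsts} (hR : R.WF) {U : ℝ} (hU : 0 < U) (hU1 : U ≤ 1)
    {Nsc : ℕ} {μ : ℝ} {K : TrigPolyC4v} (hK : FrameOK R U Nsc μ K) {β : ℝ} (hβ : klBetaMin ≤ β) (hβL : β ≤ L)
    (hβM : β ^ 3 ≤ (M : ℝ)) (hθ : klScaleZeroThetaC R * U ≤ 1 / 2) {B : ℝ}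
    (hvals : ∀ k₁ ∈ klBall L μ K, ∀ k₂ ∈ klBall L μ K, ∀ k₃ ∈ klBall L μ K, ‖klQuarticValue L M β U μ K 0 0 1 k₁ k₂ k₃‖ ≤ B)
    {q : TorusSite 2 L} (hq : q ∈ klBall L μ K) :
    U - klScaleZeroValC R * U ^ 2 ≤ B := by
  have hv := hvals q hq q hq q hq
  rw [klka_quarticValue_eq_pairAmplitude] at hv
  have hdev := norm_klPairAmplitude_zero_sub_le_sq (L := L) (M := M) hR hU hU1 hK hβ hβL hβM hθ (q + q) q q
  -- `‖𝒞‖ ≥ ‖U‖ − ‖𝒞 − U‖`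
  have htri : ‖(U : ℂ)‖ - ‖klPairAmplitude L M β U μ K 0 (q + q) q q - (U : ℂ)‖ ≤ ‖klPairAmplitude L M β U μ K 0 (q + q) q q‖ := by
    have := norm_sub_norm_le (U : ℂ) ((U : ℂ) - klPairAmplitude L M β U μ K 0 (q + q) q q)
    rw [sub_sub_cancel, norm_sub_rev] at this
    linarith
  have hUn : ‖(U : ℂ)‖ = U := by rw [Complex.norm_real, Real.norm_eq_abs, abs_of_pos hU]
  linarith

/-! ## §3 The remainder of the scale-`0` step against the values constant -/

/-- **`(N/β)·R₄ ≤ klScaleZeroValC R·U²/96`** for the step data of `…ScaleZeroValuesExplicit` (`κ₀ = ρ` sharp, `α = (N/β)klScaleZeroA0`,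
`N₁ = (β/N)·klKappaFrameC R·|U|`, `θ ≤ klScaleZeroThetaC R·U ≤ 1/2`) — the algebra of `norm_klPairAmplitude_zero_sub_le_sq` without the pair amplitude:
`θ ≤ klScaleZeroThetaC R·U`, `θ < 1`, and the remainder bound. -/
theorem scaleZero_remainder_le [NeZero M] {R : RenConsts} (hR : R.WF) {U : ℝ} (hU : 0 < U) {β : ℝ} (hβ0 : 0 < β)
    (hθ : klScaleZeroThetaC R * U ≤ 1 / 2) :
    Real.exp 1 * ((((2 * (2 * M) : ℕ) : ℝ)) / β * klScaleZeroA0) *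
          normV (GridLeg (GridPoint L (2 * (2 * M)))) (Real.sqrt (2 * (7 + 6047))) (Real.sqrt (2 * (7 + 6047)))
            (fun m' : ℕ => if m' = 1 then |β| / (2 * (2 * M) : ℕ) * (klKappaFrameC R * |U|)
              else if m' = 2 then |U| * |β| / (2 * (2 * M) : ℕ) else 0) / Real.sqrt (2 * (7 + 6047)) ^ 2 ≤ klScaleZeroThetaC R * U ∧
    Real.exp 1 * ((((2 * (2 * M) : ℕ) : ℝ)) / β * klScaleZeroA0) *
          normV (GridLeg (GridPoint L (2 * (2 * M)))) (Real.sqrt (2 * (7 + 6047))) (Real.sqrt (2 * (7 + 6047)))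
            (fun m' : ℕ => if m' = 1 then |β| / (2 * (2 * M) : ℕ) * (klKappaFrameC R * |U|)
              else if m' = 2 then |U| * |β| / (2 * (2 * M) : ℕ) else 0) / Real.sqrt (2 * (7 + 6047)) ^ 2 < 1 ∧
    (((2 * (2 * M) : ℕ) : ℝ)) / β *
        ((Real.sqrt (2 * (7 + 6047)))⁻¹ ^ 4 *
            (Real.exp 1 * normV (GridLeg (GridPoint L (2 * (2 * M)))) (Real.sqrt (2 * (7 + 6047))) (Real.sqrt (2 * (7 + 6047)))
            (fun m' : ℕ => if m' = 1 then |β| / (2 * (2 * M) : ℕ) * (klKappaFrameC R * |U|)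
              else if m' = 2 then |U| * |β| / (2 * (2 * M) : ℕ) else 0)) *
          (Real.exp 1 * ((((2 * (2 * M) : ℕ) : ℝ)) / β * klScaleZeroA0) *
          normV (GridLeg (GridPoint L (2 * (2 * M)))) (Real.sqrt (2 * (7 + 6047))) (Real.sqrt (2 * (7 + 6047)))
            (fun m' : ℕ => if m' = 1 then |β| / (2 * (2 * M) : ℕ) * (klKappaFrameC R * |U|)
              else if m' = 2 then |U| * |β| / (2 * (2 * M) : ℕ) else 0) / Real.sqrt (2 * (7 + 6047)) ^ 2) /
          (1 - Real.exp 1 * ((((2 * (2 * M) : ℕ) : ℝ)) / β * klScaleZeroA0) *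
          normV (GridLeg (GridPoint L (2 * (2 * M)))) (Real.sqrt (2 * (7 + 6047))) (Real.sqrt (2 * (7 + 6047)))
            (fun m' : ℕ => if m' = 1 then |β| / (2 * (2 * M) : ℕ) * (klKappaFrameC R * |U|)
              else if m' = 2 then |U| * |β| / (2 * (2 * M) : ℕ) else 0) / Real.sqrt (2 * (7 + 6047)) ^ 2)) ≤
      klScaleZeroValC R * U ^ 2 / 96 := by
  -- notation
  set Ng : ℕ := 2 * (2 * M) with hNg
  haveI : NeZero Ng := ⟨by rw [hNg]; have := NeZero.ne M; omega⟩
  set κ₀ : ℝ := Real.sqrt (2 * (7 + 6047)) with hκ₀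
  set V : ℝ := normV (GridLeg (GridPoint L Ng)) κ₀ κ₀
    (fun m' : ℕ => if m' = 1 then |β| / (Ng : ℕ) * (klKappaFrameC R * |U|) else if m' = 2 then |U| * |β| / (Ng : ℕ) else 0) with hV
  have hN0 : 0 < ((Ng : ℕ) : ℝ) := by exact_mod_cast Nat.pos_of_ne_zero (NeZero.ne Ng)
  have hUabs : |U| = U := abs_of_pos hU
  have hG0 : 0 ≤ R.Gfr 0 := hR.2.2 0
  have hκ : 0 < κ₀ := Real.sqrt_pos.2 (by norm_num)
  have hA0 := klScaleZeroA0_pos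
  have hCV := klScaleZeroCV_pos hG0
  have hKC : 0 ≤ klKappaFrameC R := (klKappaFrameC_pos hG0).le
  have hVeq : V = (Real.exp 2 * (κ₀ + κ₀)) ^ 2 * (|β| / Ng * (klKappaFrameC R * |U|)) +
      (Real.exp 2 * (κ₀ + κ₀)) ^ 4 * (|U| * |β| / Ng) :=
    normV_scaleZeroPinnedL1_eq four_le_card_gridLeg κ₀ κ₀ β U (klKappaFrameC R * |U|) Ng
  have hNV : ((Ng : ℕ) : ℝ) / β * V = klScaleZeroCV R * U := by
    rw [hVeq, abs_of_pos hβ0, hUabs, klScaleZeroCV, ← hκ₀, show κ₀ + κ₀ = 2 * κ₀ by ring]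
    field_simp
  have hV0 : 0 ≤ V := by
    rw [hVeq, abs_of_pos hβ0, hUabs]; positivity
  -- the smallness
  have hθeq : Real.exp 1 * (((Ng : ℕ) : ℝ) / β * klScaleZeroA0) * V / κ₀ ^ 2 =
      Real.exp 1 * klScaleZeroA0 * (((Ng : ℕ) : ℝ) / β * V) / κ₀ ^ 2 := by ring
  have hθle : Real.exp 1 * (((Ng : ℕ) : ℝ) / β * klScaleZeroA0) * V / κ₀ ^ 2 ≤ klScaleZeroThetaC R * U := by
    rw [hθeq, hNV, klScaleZeroThetaC, ← hκ₀]
    exact le_of_eq (by ring)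
  have hθhalf : Real.exp 1 * (((Ng : ℕ) : ℝ) / β * klScaleZeroA0) * V / κ₀ ^ 2 ≤ 1 / 2 := hθle.trans hθ
  have hθ0 : 0 ≤ Real.exp 1 * (((Ng : ℕ) : ℝ) / β * klScaleZeroA0) * V / κ₀ ^ 2 := by positivity
  refine ⟨hθle, by linarith, ?_⟩
  set θ : ℝ := Real.exp 1 * (((Ng : ℕ) : ℝ) / β * klScaleZeroA0) * V / κ₀ ^ 2 with hθdef
  have hfrac : θ / (1 - θ) ≤ 2 * (klScaleZeroThetaC R * U) := by
    rw [div_le_iff₀ (by linarith)]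
    nlinarith [mul_nonneg hθ0 (by linarith : (0:ℝ) ≤ klScaleZeroThetaC R * U)]
  calc ((Ng : ℕ) : ℝ) / β * (κ₀⁻¹ ^ 4 * (Real.exp 1 * V) * θ / (1 - θ))
      = κ₀⁻¹ ^ 4 * (Real.exp 1 * (((Ng : ℕ) : ℝ) / β * V)) * (θ / (1 - θ)) := by ring
    _ ≤ κ₀⁻¹ ^ 4 * (Real.exp 1 * (klScaleZeroCV R * U)) * (2 * (klScaleZeroThetaC R * U)) := by
        rw [hNV]
        exact mul_le_mul_of_nonneg_left hfrac (by positivity)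
    _ = klScaleZeroValC R * U ^ 2 / 96 := by rw [klScaleZeroValC_eq, ← hκ₀]; ring

/-! ## §4 (E5-S)₀ -/

/-- **(E5-S)₀ `IsoTupleL1AtS … 0` for every admissible frame, modulo the isotropic torus bound and two package numbers.**
Hypotheses: `FrameOK R U N μ K`, `R.WF`, `0 < U ≤ 1`, `klBetaMin ≤ β ≤ L`, `β³ ≤ M`; the package smallnesses `klScaleZeroThetaC R·U ≤ 1/2`
and `klScaleZeroValC R·U ≤ 1/4` (a `U₀(R)`-threshold); ONE dimensionless bound `T̂` with `T_iso(m; ω, c) ≤ T̂/ε_x` for the product-torus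
`ℓ¹` sums of EVERY isotropic family `klIsoFamily … klE0 m` (the isotropic sector lemma); and the package number `T̂⁴ ≤ G.CF`.
FINDING (route-intrinsic): the bare vertex contributes `T̂⁴·U/2`, linear in `U`, so only `G.CF·B` (with `B ≍ U`) can absorb it — `G.CF ≥ T̂⁴/…`
is NECESSARY here, and `G` is the engine's FIRST witness: with the tree's certified sector constants this asks for a by-name `G.CF`. -/
theorem isoTupleL1AtS_zero_of_torusSum [NeZero M] {G : GeoConsts} {P : SplitConsts} {R : RenConsts} (hR : R.WF)
    {U : ℝ} (hU : 0 < U) (hU1 : U ≤ 1) {Nsc : ℕ} {μ : ℝ} {K : TrigPolyC4v} (hK : FrameOK R U Nsc μ K)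
    {β : ℝ} (hβ : klBetaMin ≤ β) (hβL : β ≤ L) (hβM : β ^ 3 ≤ (M : ℝ))
    (hθ : klScaleZeroThetaC R * U ≤ 1 / 2) (hUval : klScaleZeroValC R * U ≤ 1 / 4)
    {Th : ℝ} (hTh0 : 0 ≤ Th)
    (hT : ∀ (m : ℕ) (ω : Fin (sectorCount (2 * m))) (c : Fin 2), 1 / (|β| * (L : ℝ) ^ 2) *
        ∑ dw : TorusSite 1 (2 * (2 * M)) × TorusSite 2 L, ‖∑ k : FreqMomentum L M, klIsoFamily L M β μ K klE0 m ω k *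
          (if c = 0 then torusChar (fun _ : Fin 1 => ((k.1 : ℕ) : ZMod (2 * (2 * M)))) dw.1 * torusChar k.2 dw.2
            else conj (torusChar (fun _ : Fin 1 => ((k.1 : ℕ) : ZMod (2 * (2 * M)))) dw.1 * torusChar k.2 dw.2))‖ ≤
        Th / imagTimeWeight β M)
    (hCF : Th ^ 4 ≤ G.CF) :
    IsoTupleL1AtS L M G P β U μ K 0 := by
  intro B hB hvals m _ Ω hΩ x₁
  -- signs
  haveI : NeZero (2 * (2 * M)) := ⟨by have := NeZero.ne M; omega⟩
  have hβ0 : 0 < β := beta_pos_of_klBetaMin_le hβ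
  have hN0 : 0 < (((2 * (2 * M) : ℕ) : ℝ)) := by exact_mod_cast Nat.pos_of_ne_zero (NeZero.ne (2 * (2 * M)))
  have hNgr : (((2 * (2 * M) : ℕ) : ℝ)) = 4 * M := by push_cast; ring
  have hM0 : (0 : ℝ) < M := by exact_mod_cast Nat.pos_of_ne_zero (NeZero.ne M)
  have hUabs : |U| = U := abs_of_pos hU
  have hU1' : |U| ≤ 1 := by rwa [hUabs]
  have hG0 : 0 ≤ R.Gfr 0 := hR.2.2 0
  have hκ : 0 < Real.sqrt (2 * (7 + 6047)) := Real.sqrt_pos.2 (by norm_num)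
  have hε : 0 < imagTimeWeight β M := by rw [imagTimeWeight]; positivity
  -- the step data (as in `…ScaleZeroValuesExplicit`)
  have hαpos : 0 < (((2 * (2 * M) : ℕ) : ℝ)) / β * klScaleZeroA0 := by have := klScaleZeroA0_pos; positivity
  have hrow := fun X => rowSum_scaleZero_le_A0 (L := L) (μ := μ) hK hβ hβM X
  have hcol := fun Y => colSum_scaleZero_le_A0 (L := L) (μ := μ) hK hβ hβM Y
  have hkKframe : ∑ z : TorusSite 2 L, ‖framePosKernel L K z‖ ≤ klKappaFrameC R * |U| :=
    sum_norm_framePosKernel_le_linear_of_frameOK hR hU.ne' hU1' hK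
  have hN₁0 : 0 ≤ |β| / (2 * (2 * M) : ℕ) * (klKappaFrameC R * |U|) := by
    have := (klKappaFrameC_pos hG0).le; positivity
  have hct : ∀ (j : Fin 2) (w : GridLeg (GridPoint L (2 * (2 * M)))),
      ∑ Y ∈ univ.filter (fun Y : Fin 2 → GridLeg (GridPoint L (2 * (2 * M))) => Y j = w),
        ‖kernel ℂ (hubbardGridCounterQuadratic L (2 * (2 * M)) β K) 2 Y‖ ≤
          |β| / (2 * (2 * M) : ℕ) * (klKappaFrameC R * |U|) := fun j w =>
    (sum_norm_kernel_hubbardGridCounterQuadratic_le_l1 β K j w).trans (mul_le_mul_of_nonneg_left hkKframe (by positivity))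
  obtain ⟨-, hθ1, hrem⟩ := scaleZero_remainder_le (L := L) (M := M) hR hU hβ0 hθ
  -- (1) the fixed-tuple Young bound with `T := T̂/ε_x`
  have hT0 : 0 ≤ Th / imagTimeWeight β M := div_nonneg hTh0 hε.le
  have hfix := fixedTupleL1_klIsoKernelAt_zero_le_of_torusSum (L := L) (M := M) hβ0 U μ K hκ
    (isGramBoundedR_scaleZero_of_frameOK_sharp hK hβ hβL) hαpos hrow hcol hκ hN₁0 hct hθ1 m hT0 (hT m) Ω x₁
  -- (2) name the remainder; `(ε·T̂/ε)³·(T̂/ε)·(Uβ/N + r) ≤ T̂⁴·(U/2 + ValC·U²/192)`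
  set r : ℝ := (Real.sqrt (2 * (7 + 6047)))⁻¹ ^ 4 *
            (Real.exp 1 * normV (GridLeg (GridPoint L (2 * (2 * M)))) (Real.sqrt (2 * (7 + 6047))) (Real.sqrt (2 * (7 + 6047)))
            (fun m' : ℕ => if m' = 1 then |β| / (2 * (2 * M) : ℕ) * (klKappaFrameC R * |U|)
              else if m' = 2 then |U| * |β| / (2 * (2 * M) : ℕ) else 0)) *
          (Real.exp 1 * ((((2 * (2 * M) : ℕ) : ℝ)) / β * klScaleZeroA0) *
          normV (GridLeg (GridPoint L (2 * (2 * M)))) (Real.sqrt (2 * (7 + 6047))) (Real.sqrt (2 * (7 + 6047)))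
            (fun m' : ℕ => if m' = 1 then |β| / (2 * (2 * M) : ℕ) * (klKappaFrameC R * |U|)
              else if m' = 2 then |U| * |β| / (2 * (2 * M) : ℕ) else 0) / Real.sqrt (2 * (7 + 6047)) ^ 2) /
          (1 - Real.exp 1 * ((((2 * (2 * M) : ℕ) : ℝ)) / β * klScaleZeroA0) *
          normV (GridLeg (GridPoint L (2 * (2 * M)))) (Real.sqrt (2 * (7 + 6047))) (Real.sqrt (2 * (7 + 6047)))
            (fun m' : ℕ => if m' = 1 then |β| / (2 * (2 * M) : ℕ) * (klKappaFrameC R * |U|)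
              else if m' = 2 then |U| * |β| / (2 * (2 * M) : ℕ) else 0) / Real.sqrt (2 * (7 + 6047)) ^ 2) with hr
  have hεT : imagTimeWeight β M * (Th / imagTimeWeight β M) = Th := mul_div_cancel₀ Th hε.ne'
  rw [hεT] at hfix
  have hkey : Th / imagTimeWeight β M * (|U| * |β| / (2 * (2 * M) : ℕ) + r) ≤
      Th * (U / 2 + klScaleZeroValC R * U ^ 2 / 192) := by
    have h1 : Th / imagTimeWeight β M * (|U| * |β| / (2 * (2 * M) : ℕ) + r) =
        Th * (U / 2 + ((((2 * (2 * M) : ℕ) : ℝ)) / β * r) / 2) := by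
      rw [imagTimeWeight, hUabs, abs_of_pos hβ0, hNgr]
      field_simp
      ring
    rw [h1]
    refine mul_le_mul_of_nonneg_left ?_ hTh0
    linarith
  have hbound : fixedTupleL1 L M β 3 (klIsoKernelAt L M β U μ K 0 m) Ω x₁ ≤ Th ^ 4 * (U / 2 + klScaleZeroValC R * U ^ 2 / 192) := by
    calc fixedTupleL1 L M β 3 (klIsoKernelAt L M β U μ K 0 m) Ω x₁
        ≤ Th ^ 3 * (Th / imagTimeWeight β M) * (|U| * |β| / (2 * (2 * M) : ℕ) + r) := hfix
      _ = Th ^ 3 * (Th / imagTimeWeight β M * (|U| * |β| / (2 * (2 * M) : ℕ) + r)) := by ring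
      _ ≤ Th ^ 3 * (Th * (U / 2 + klScaleZeroValC R * U ^ 2 / 192)) := mul_le_mul_of_nonneg_left hkey (pow_nonneg hTh0 3)
      _ = Th ^ 4 * (U / 2 + klScaleZeroValC R * U ^ 2 / 192) := by ring
  -- (3) the lower bound on `B` from one ball point of the admissible tuple
  obtain ⟨q, hq⟩ := exists_mem_klBall_of_mem_bgmSectorSet β μ K m hΩ
  have hBlow : U - klScaleZeroValC R * U ^ 2 ≤ B := sub_le_of_values_le hR hU hU1 hK hβ hβL hβM hθ hvals hq
  -- (4) `T̂⁴·(U/2 + ValC U²/192) ≤ G.CF·B ≤ G.CF·B + G.CF·(Klam U)²`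
  have hCF0 : 0 ≤ G.CF := le_trans (by positivity) hCF
  have hTh4 : 0 ≤ Th ^ 4 := by positivity
  have hKU : 0 ≤ G.CF * (P.Klam * U) ^ 2 := by positivity
  have hValC0 : 0 ≤ klScaleZeroValC R := (klScaleZeroValC_pos hG0).le
  refine hbound.trans ?_
  have hVU : klScaleZeroValC R * U ^ 2 ≤ U / 4 := by nlinarith
  have h1 : Th ^ 4 * (U / 2 + klScaleZeroValC R * U ^ 2 / 192) ≤ G.CF * (U - klScaleZeroValC R * U ^ 2) := by
    nlinarith [mul_nonneg hTh4 hU.le, mul_nonneg hCF0 hU.le, mul_nonneg (sub_nonneg.2 hCF) hU.le,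
      mul_nonneg hTh4 (by positivity : (0:ℝ) ≤ klScaleZeroValC R * U ^ 2)]
  have h2 : G.CF * (U - klScaleZeroValC R * U ^ 2) ≤ G.CF * B := mul_le_mul_of_nonneg_left hBlow hCF0
  linarith

/-- **(E5-S)₀ under the ENGINE's binders** (`klEngL₃ β U ≤ L`, `klEngM₃ β U L ≤ M` give `β ≤ L`, `β³ ≤ M`), leaving the isotropic torus bound
`T̂` and the three package conditions `klScaleZeroThetaC R·U ≤ 1/2`, `klScaleZeroValC R·U ≤ 1/4`, `T̂⁴ ≤ G.CF`. -/
theorem isoTupleL1AtS_zero_of_klEng [NeZero M] {G : GeoConsts} {P : SplitConsts} {R : RenConsts} (hR : R.WF)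
    {U : ℝ} (hU : 0 < U) (hU1 : U ≤ 1) {μ : ℝ} {K : TrigPolyC4v} {β : ℝ} (hβ : klBetaMin ≤ β) (hK : FrameOK R U (nScales β) μ K)
    (hL : klEngL₃ β U ≤ L) (hM : klEngM₃ β U L ≤ M)
    (hθ : klScaleZeroThetaC R * U ≤ 1 / 2) (hUval : klScaleZeroValC R * U ≤ 1 / 4)
    {Th : ℝ} (hTh0 : 0 ≤ Th)
    (hT : ∀ (m : ℕ) (ω : Fin (sectorCount (2 * m))) (c : Fin 2), 1 / (|β| * (L : ℝ) ^ 2) *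
        ∑ dw : TorusSite 1 (2 * (2 * M)) × TorusSite 2 L, ‖∑ k : FreqMomentum L M, klIsoFamily L M β μ K klE0 m ω k *
          (if c = 0 then torusChar (fun _ : Fin 1 => ((k.1 : ℕ) : ZMod (2 * (2 * M)))) dw.1 * torusChar k.2 dw.2
            else conj (torusChar (fun _ : Fin 1 => ((k.1 : ℕ) : ZMod (2 * (2 * M)))) dw.1 * torusChar k.2 dw.2))‖ ≤
        Th / imagTimeWeight β M)
    (hCF : Th ^ 4 ≤ G.CF) :
    IsoTupleL1AtS L M G P β U μ K 0 :=
  isoTupleL1AtS_zero_of_torusSum hR hU hU1 hK hβ (le_of_klEngL₃_le hL) (pow_three_le_of_klEng hβ hL hM) hθ hUval hTh0 hT hCF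

end Summit.HubbardSuperconductivity.HubbardSuperconductivity.Theorems.EngineV8

end
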